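import Literature.MathematicalPhysics.QuantumFieldTheory.MullerSchiemann1987.MS87MigdalRecursion
import Literature.Analysis.Complex.HolomorphicParametricIntegral
import Literature.Analysis.Complex.SeparatelyHolomorphicStrips
import HarnessLib

/-!
# Müller–Schiemann, *Continuum limit of a hierarchical SU(2) lattice gauge theory in 4 dimensions*
# (CMP 110, 1987), FROM THE PROOF OF THEOREM 3 (p.283, last paragraph) WITH (3.1) (p.266): the analytically
# continued recursion `J(u, z) = ∫dv g̃(uv⁻¹, z/2) g̃(v, z/2)` is holomorphic on the WIDER strip `|Im z| < 2d`
# — PROVED (abstract compact group; theorems only; no definition, no named fact)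

statement-level skeleton of published theorems with citation tags; proofs where landed; nothing here is a claim about the Yang–Mills mass gap

**Citation header (reproduction of PUBLISHED work).** V. F. Müller, J. Schiemann, *Continuum limit of a hierarchical
SU(2) lattice gauge theory in 4 dimensions*, Commun. Math. Phys. **110** (1987) 261–286, doi 10.1007/BF01207367
[MullerSchiemann1987]; (3.1) p.266, (A₁) p.266, Theorem 3 p.282 and the last paragraph of its proof p.283 L.40–45
(held Project Euclid scan `paper:url-96df5da18d4c`; displays read by this seat on its own 3× page renders
`run/shared/lean/pub/lit-balaban/lit-balaban-p12/renders-cmp110ms/ms87-cmp110-pdfp006,023-journalp266,283-x3.png`).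
Lean lane of the lit-balaban YM LIT SWEEP CONTEXT row X1 (register level; zero weight for any token of that table); the
model is the `d = 4` HIERARCHICAL `SU(2)` gauge model, NOT lattice Yang–Mills.

**What the paper prints.** (3.1) p.266: *«The functions g̃^{(n)}(u, z), (2.7), are inductively defined by the
analytically continued recursion relation (2.4) of Migdal,
g̃^{(n+1)}(u, z) = (1/𝒩){∫dv g̃^{(n)}(uv⁻¹, z/2) g̃^{(n)}(v, z/2)}².»* Proof of Theorem 3, p.283 L.40–45: *«Finally the
analytically extended version of 𝒯, (3.1), (3.8), when applied to g̃^{(−n−1)}(u, z) as given by (6.21), yields an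
analytic continuation of g̃^{(−n)}(u, z) to the wider strip z ∈ ℂ, |Im z| < r·(κ/2)(β^{(−n−1)})^{−α}. Iterating this
argument, with r^m(β^{(−n−m)})^{−α} → ∞ (m → ∞), shows that g̃^{(−n)}(u, z) is entire in z ∈ ℂ for all n. □»*
((6.21): g̃^{(−n−1)} is «continuous in u ∈ G and holomorphic in z» on the strip `|Im z| < d`.)

**What this file proves (kernel-checked, 0 sorry, standard axioms; no definition, no named fact).** For an arbitrary
compact group `G` with its normalised Haar measure (the tree's `haarProbability G`) and a family `g̃ : G → ℂ → ℂ`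
that is jointly continuous on `G × {|Im z| < d}` and holomorphic in `z` there (the output of (6.21)), with `r = 2`:
* §1 strip geometry (`abs_im_half_lt`: `|Im z| < 2d ⟹ |Im(z/2)| < d`; ball/closed-ball estimates of `|Im|`);
* §2 **the «wider strip»**: `J(u, z) := ∫dv g̃(uv⁻¹, z/2) g̃(v, z/2)` is HOLOMORPHIC on `{|Im z| < 2d}` for every `u`
  (`differentiableOn_J` — holomorphy of dominated parameter integrals, the tree's
  `Literature.Analysis.Complex.differentiableOn_integral_of_dominated`, the local majorant coming from compactness of
  `G × closed ball` and joint continuity) and JOINTLY CONTINUOUS on `G × {|Im z| < 2d}` (`continuousOn_J`, dominated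
  convergence; `G` first countable);
* §3 hence the continued Migdal image **(3.1)** `g̃′(u, z) = (J(u, z)/𝒩′)²` (any constant `𝒩′`; the paper's `1/𝒩`
  with `𝒩 = M²`) is holomorphic on the wider strip and jointly continuous there (`differentiableOn_eq31`,
  `continuousOn_eq31`);
* §4 **«Iterating this argument … shows that g̃ is entire»**: a function holomorphic on the strips `{|Im z| < c_m}`
  with `c_m → ∞` — e.g. `c_m = r^m d`, `r > 1`, `d > 0` — is entire (`differentiable_of_strips`,
  `differentiable_of_strips_pow`).

**Readings / scope (declared).** (i) Only the case `r = 2` ((3.1)) of the continued recursion is written out; (3.8)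
(`r = 4`, arguments `z/4`) is the same argument and is not repeated. (ii) The file proves the MECHANISM of the last
paragraph for an abstract family `g̃`; the objects `g̃^{(−n)}` of Theorem 3 (limits (6.19)/(6.22)), the identification
of the continued `𝒯g̃^{(−n−1)}` with `g̃^{(−n)}` on the smaller strip (uniqueness of analytic continuation, cf. the
sibling `MS87Theorem3Continuation.eq621_unique`) and Theorem 3 itself are NOT formalized here.

**Not claimed.** Theorem 3; (3.8); anything about lattice Yang–Mills or the Clay problem.
-/

open MeasureTheory Metric Set Filter
open scoped Topology

namespace Literature.MathematicalPhysics.QuantumFieldTheory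

namespace MullerSchiemann1987

namespace MigdalStripWidening

open Literature.MathematicalPhysics.QuantumFieldTheory (haarProbability)
open Literature.Analysis.Complex (differentiableOn_integral_of_dominated isOpen_setOf_abs_im_lt)

/-! ## §1 Strip geometry -/

/-- `|Im z| < 2d ⟹ |Im(z/2)| < d`: halving the argument, as in (3.1), maps the wider strip into the strip.
[cite: MullerSchiemann1987, (3.1) p.266, p.283 L.40–43] -/
theorem abs_im_half_lt {d : ℝ} {z : ℂ} (hz : |z.im| < 2 * d) : |(z / 2).im| < d := by
  rw [Complex.div_ofNat_im, abs_div, abs_two]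
  linarith

/-- `|Im z| ≤ |Im z₀| + ‖z − z₀‖`. [cite: MullerSchiemann1987, p.283 L.40–43] -/
theorem abs_im_le_abs_im_add_norm_sub (z z₀ : ℂ) : |z.im| ≤ |z₀.im| + ‖z - z₀‖ := by
  have h1 : |(z - z₀).im| ≤ ‖z - z₀‖ := Complex.abs_im_le_norm _
  have e : z.im = z₀.im + (z - z₀).im := by simp
  calc |z.im| = |z₀.im + (z - z₀).im| := by rw [← e]
    _ ≤ |z₀.im| + |(z - z₀).im| := abs_add_le _ _
    _ ≤ |z₀.im| + ‖z - z₀‖ := by linarith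

/-- In the ball `‖z − z₀‖ < R`: `|Im z| < |Im z₀| + R`. [cite: MullerSchiemann1987, p.283 L.40–43] -/
theorem abs_im_lt_of_mem_ball {z z₀ : ℂ} {R : ℝ} (hz : z ∈ ball z₀ R) : |z.im| < |z₀.im| + R := by
  rw [mem_ball, dist_eq_norm] at hz
  have := abs_im_le_abs_im_add_norm_sub z z₀
  linarith

/-- In the closed ball `‖w − c‖ ≤ ρ`: `|Im w| ≤ |Im c| + ρ`. [cite: MullerSchiemann1987, p.283 L.40–43] -/
theorem abs_im_le_of_mem_closedBall {w c : ℂ} {ρ : ℝ} (hw : w ∈ closedBall c ρ) : |w.im| ≤ |c.im| + ρ := by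
  rw [mem_closedBall, dist_eq_norm] at hw
  have := abs_im_le_abs_im_add_norm_sub w c
  linarith

/-- Halving maps the ball `‖z − z₀‖ < R` into the closed ball `‖w − z₀/2‖ ≤ R/2`. [cite: MullerSchiemann1987, (3.1)
p.266] -/
theorem half_mem_closedBall {z z₀ : ℂ} {R : ℝ} (hz : z ∈ ball z₀ R) : z / 2 ∈ closedBall (z₀ / 2) (R / 2) := by
  rw [mem_ball, dist_eq_norm] at hz
  rw [mem_closedBall, dist_eq_norm, show z / 2 - z₀ / 2 = (z - z₀) / 2 by ring, norm_div, Complex.norm_two]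
  linarith

section CompactGroup

variable {G : Type*} [Group G] [TopologicalSpace G] [IsTopologicalGroup G] [CompactSpace G]
  [MeasurableSpace G] [BorelSpace G]

/-! ## §2 The continued convolution `J(u, z) = ∫dv g̃(uv⁻¹, z/2) g̃(v, z/2)` on the wider strip -/

omit [Group G] [IsTopologicalGroup G] [CompactSpace G] [MeasurableSpace G] [BorelSpace G] in
/-- Sections `v ↦ g̃(φ(v), ζ)` of a jointly continuous family are continuous (`ζ` in the strip, `φ` continuous).
[cite: MullerSchiemann1987, (6.21) p.283 («continuous in u ∈ G»)] -/
theorem continuous_section {d : ℝ} {gt : G → ℂ → ℂ}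
    (hcont : ContinuousOn (Function.uncurry gt) (univ ×ˢ {z : ℂ | |z.im| < d})) {ζ : ℂ} (hζ : |ζ.im| < d)
    {φ : G → G} (hφ : Continuous φ) : Continuous fun v => gt (φ v) ζ :=
  hcont.comp_continuous (hφ.prodMk continuous_const) fun _ => ⟨mem_univ _, hζ⟩

omit [Group G] [IsTopologicalGroup G] [MeasurableSpace G] [BorelSpace G] in
/-- A uniform bound for `g̃` on `G × (closed ball)` inside `G × strip` (compactness + joint continuity), in the form
used for the local majorant: for `|Im z₀| < 2d` and `R = (2d − |Im z₀|)/2` there is `C` with `‖g̃(w, z/2)‖ ≤ C` for all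
`w ∈ G`, `‖z − z₀‖ < R`. [cite: MullerSchiemann1987, p.283 L.40–43] -/
theorem exists_bound_half {d : ℝ} {gt : G → ℂ → ℂ}
    (hcont : ContinuousOn (Function.uncurry gt) (univ ×ˢ {z : ℂ | |z.im| < d})) {z₀ : ℂ} (hz₀ : |z₀.im| < 2 * d) :
    ∃ C : ℝ, 0 ≤ C ∧ ∀ (w : G) (z : ℂ), z ∈ ball z₀ ((2 * d - |z₀.im|) / 2) → ‖gt w (z / 2)‖ ≤ C := by
  set R : ℝ := (2 * d - |z₀.im|) / 2 with hR
  set K : Set (G × ℂ) := univ ×ˢ closedBall (z₀ / 2) (R / 2) with hK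
  have hKc : IsCompact K := isCompact_univ.prod (isCompact_closedBall _ _)
  have hKsub : K ⊆ univ ×ˢ {z : ℂ | |z.im| < d} := by
    rintro ⟨w, ζ⟩ ⟨-, hζ⟩
    refine ⟨mem_univ _, ?_⟩
    show |ζ.im| < d
    have h1 := abs_im_le_of_mem_closedBall hζ
    rw [Complex.div_ofNat_im, abs_div, abs_two, hR] at h1
    linarith
  obtain ⟨C, hC⟩ := hKc.exists_bound_of_continuousOn (hcont.mono hKsub)
  refine ⟨max C 0, le_max_right _ _, fun w z hz => ?_⟩
  have hmem : (w, z / 2) ∈ K := ⟨mem_univ _, half_mem_closedBall hz⟩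
  exact (hC (w, z / 2) hmem).trans (le_max_left _ _)

/-- **«an analytic continuation … to the wider strip»** (p.283 with (3.1)): if `g̃` is jointly continuous on
`G × {|Im z| < d}` and `g̃(w, ·)` is holomorphic on `{|Im z| < d}` for every `w ∈ G`, then for every `u ∈ G` the
continued convolution `J(u, z) = ∫dv g̃(uv⁻¹, z/2) g̃(v, z/2)` is holomorphic on the wider strip `{|Im z| < 2d}`
(holomorphy of dominated parameter integrals; the majorant is a constant from compactness of `G`).
[cite: MullerSchiemann1987, (3.1) p.266, Thm 3 proof p.283 L.40–43] -/
theorem differentiableOn_J {d : ℝ} {gt : G → ℂ → ℂ}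
    (hcont : ContinuousOn (Function.uncurry gt) (univ ×ˢ {z : ℂ | |z.im| < d}))
    (hhol : ∀ w : G, DifferentiableOn ℂ (gt w) {z : ℂ | |z.im| < d}) (u : G) :
    DifferentiableOn ℂ (fun z : ℂ => ∫ v, gt (u * v⁻¹) (z / 2) * gt v (z / 2) ∂(haarProbability G))
      {z : ℂ | |z.im| < 2 * d} := by
  refine differentiableOn_integral_of_dominated (fun z hz => ?_) (Eventually.of_forall fun v => ?_)
    fun z₀ hz₀ => ?_
  · -- measurability of the sections
    have hζ : |(z / 2).im| < d := abs_im_half_lt hz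
    exact ((continuous_section hcont hζ (continuous_const.mul continuous_inv)).mul
      (continuous_section hcont hζ continuous_id)).aestronglyMeasurable
  · -- holomorphy in `z` for fixed `v`
    have hmaps : MapsTo (fun z : ℂ => z / 2) {z : ℂ | |z.im| < 2 * d} {z : ℂ | |z.im| < d} :=
      fun z hz => abs_im_half_lt hz
    have hdiv : DifferentiableOn ℂ (fun z : ℂ => z / 2) {z : ℂ | |z.im| < 2 * d} :=
      (differentiable_id.div_const (2 : ℂ)).differentiableOn
    exact ((hhol (u * v⁻¹)).comp hdiv hmaps).mul ((hhol v).comp hdiv hmaps)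
  · -- local constant majorant
    have hz₀' : |z₀.im| < 2 * d := hz₀
    obtain ⟨C, hC0, hC⟩ := exists_bound_half hcont hz₀'
    refine ⟨(2 * d - |z₀.im|) / 2, by linarith, fun z hz => ?_, fun _ => C * C, integrable_const _,
      Eventually.of_forall fun v z hz => ?_⟩
    · show |z.im| < 2 * d
      have := abs_im_lt_of_mem_ball hz
      linarith
    · rw [norm_mul]
      exact mul_le_mul (hC _ z hz) (hC _ z hz) (norm_nonneg _) hC0

/-- **«clearly continuous in u ∈ G»** one scale up: under joint continuity of `g̃` on `G × {|Im z| < d}`, the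
continued convolution `J` is jointly continuous on `G × {|Im z| < 2d}` (dominated convergence with the constant
majorant). [cite: MullerSchiemann1987, (3.1) p.266, (6.21) p.283, Thm 3 proof p.283 L.40–43] -/
theorem continuousOn_J [FirstCountableTopology G] {d : ℝ} {gt : G → ℂ → ℂ}
    (hcont : ContinuousOn (Function.uncurry gt) (univ ×ˢ {z : ℂ | |z.im| < d})) :
    ContinuousOn
      (fun p : G × ℂ => ∫ v, gt (p.1 * v⁻¹) (p.2 / 2) * gt v (p.2 / 2) ∂(haarProbability G))
      (univ ×ˢ {z : ℂ | |z.im| < 2 * d}) := by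
  rintro ⟨u₀, z₀⟩ ⟨-, hz₀⟩
  have hz₀' : |z₀.im| < 2 * d := hz₀
  have hS : IsOpen {z : ℂ | |z.im| < d} := isOpen_setOf_abs_im_lt d
  apply ContinuousAt.continuousWithinAt
  set R : ℝ := (2 * d - |z₀.im|) / 2 with hR
  have hR0 : 0 < R := by rw [hR]; linarith
  have hN : univ ×ˢ ball z₀ R ∈ 𝓝 (u₀, z₀) := prod_mem_nhds Filter.univ_mem (ball_mem_nhds z₀ hR0)
  have hball : ∀ z ∈ ball z₀ R, |(z / 2).im| < d := fun z hz =>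
    abs_im_half_lt (by have := abs_im_lt_of_mem_ball hz; rw [hR] at this; linarith)
  obtain ⟨C, hC0, hC⟩ := exists_bound_half hcont hz₀'
  refine continuousAt_of_dominated ?_ ?_ (integrable_const (C * C)) ?_
  · filter_upwards [hN] with p hp
    exact ((continuous_section hcont (hball p.2 hp.2) (continuous_const.mul continuous_inv)).mul
      (continuous_section hcont (hball p.2 hp.2) continuous_id)).aestronglyMeasurable
  · filter_upwards [hN] with p hp
    refine Eventually.of_forall fun v => ?_
    rw [norm_mul]
    exact mul_le_mul (hC _ p.2 hp.2) (hC _ p.2 hp.2) (norm_nonneg _) hC0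
  · refine Eventually.of_forall fun v => ?_
    have h2 : |(z₀ / 2).im| < d := abs_im_half_lt hz₀'
    have hA : ContinuousAt (Function.uncurry gt) (u₀ * v⁻¹, z₀ / 2) :=
      hcont.continuousAt ((isOpen_univ.prod hS).mem_nhds ⟨mem_univ _, h2⟩)
    have hB : ContinuousAt (Function.uncurry gt) (v, z₀ / 2) :=
      hcont.continuousAt ((isOpen_univ.prod hS).mem_nhds ⟨mem_univ _, h2⟩)
    have hφ : Continuous fun p : G × ℂ => (p.1 * v⁻¹, p.2 / 2) :=
      (continuous_fst.mul continuous_const).prodMk (continuous_snd.div_const _)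
    have hψ : Continuous fun p : G × ℂ => (v, p.2 / 2) :=
      continuous_const.prodMk (continuous_snd.div_const _)
    exact (hA.comp_of_eq hφ.continuousAt rfl).mul (hB.comp_of_eq hψ.continuousAt rfl)

/-! ## §3 The continued Migdal image (3.1): `g̃′(u, z) = (J(u, z)/𝒩′)²` -/

/-- **(3.1) on the wider strip**: `g̃′(u, z) = (J(u, z)/𝒩′)²` is holomorphic on `{|Im z| < 2d}` for every `u`
(any constant `𝒩′`). [cite: MullerSchiemann1987, (3.1) p.266, Thm 3 proof p.283 L.40–43] -/
theorem differentiableOn_eq31 {d : ℝ} {gt : G → ℂ → ℂ}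
    (hcont : ContinuousOn (Function.uncurry gt) (univ ×ˢ {z : ℂ | |z.im| < d}))
    (hhol : ∀ w : G, DifferentiableOn ℂ (gt w) {z : ℂ | |z.im| < d}) (N : ℂ) (u : G) :
    DifferentiableOn ℂ
      (fun z : ℂ => ((∫ v, gt (u * v⁻¹) (z / 2) * gt v (z / 2) ∂(haarProbability G)) / N) ^ 2)
      {z : ℂ | |z.im| < 2 * d} :=
  ((differentiableOn_J hcont hhol u).div_const N).pow 2

/-- (3.1) on the wider strip is jointly continuous on `G × {|Im z| < 2d}`. [cite: MullerSchiemann1987, (3.1) p.266,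
Thm 3 proof p.283 L.40–43] -/
theorem continuousOn_eq31 [FirstCountableTopology G] {d : ℝ} {gt : G → ℂ → ℂ}
    (hcont : ContinuousOn (Function.uncurry gt) (univ ×ˢ {z : ℂ | |z.im| < d})) (N : ℂ) :
    ContinuousOn
      (fun p : G × ℂ => ((∫ v, gt (p.1 * v⁻¹) (p.2 / 2) * gt v (p.2 / 2) ∂(haarProbability G)) / N) ^ 2)
      (univ ×ˢ {z : ℂ | |z.im| < 2 * d}) :=
  ((continuousOn_J hcont).div_const N).pow 2

end CompactGroup

/-! ## §4 «Iterating this argument … shows that g̃ is entire» -/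

/-- A function holomorphic on the strips `{|Im z| < c_m}` with `c_m → ∞` is entire. [cite: MullerSchiemann1987,
Thm 3 proof p.283 L.44–45] -/
theorem differentiable_of_strips {f : ℂ → ℂ} {c : ℕ → ℝ} (hc : Tendsto c atTop atTop)
    (hf : ∀ m, DifferentiableOn ℂ f {z : ℂ | |z.im| < c m}) : Differentiable ℂ f := by
  intro z
  obtain ⟨m, hm⟩ := (hc.eventually (eventually_gt_atTop |z.im|)).exists
  exact (hf m).differentiableAt ((isOpen_setOf_abs_im_lt (c m)).mem_nhds hm)

/-- The widths `r^m d` (`r > 1`, `d > 0`) tend to infinity, so holomorphy on all the strips `{|Im z| < r^m d}`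
means entire — «with r^m(β^{(−n−m)})^{−α} → ∞». [cite: MullerSchiemann1987, Thm 3 proof p.283 L.44–45] -/
theorem differentiable_of_strips_pow {f : ℂ → ℂ} {r d : ℝ} (hr : 1 < r) (hd : 0 < d)
    (hf : ∀ m : ℕ, DifferentiableOn ℂ f {z : ℂ | |z.im| < r ^ m * d}) : Differentiable ℂ f :=
  differentiable_of_strips ((tendsto_pow_atTop_atTop_of_one_lt hr).atTop_mul_const hd) hf

end MigdalStripWidening

end MullerSchiemann1987

end Literature.MathematicalPhysics.QuantumFieldTheory
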